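import Literature.Barriers.ValiantsHypothesis.NotViaSaturationsBCI
import HarnessLib

/-!
# Klyachko's theorem on rational spectra and Kronecker coefficients (named fact), and BCI 2011 Thm. 1(2) from it

Decomposition (librarian `fact-decompose`, 2026-08-16) of the XL named fact
`Literature.Barriers.ValiantsHypothesis.BCI2011_thm1` (`NotViaSaturations.lean`:
Bürgisser–Christandl–Ikenmeyer, Adv. Math. 227 (2011), Thm. 1(2) — for `λ ⊢ ℓd` with at most `d²`
parts some stretching `g(kλ, k□, k□) ≠ 0`). Its printed proof (BCI §5.1) is PROVED in the tree
(`NotViaSaturationsBCI.lean`: `BCI2011_thm1_of_klyachko (hK) : BCI2011_thm1`, with the density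
operator of BCI Prop. 2 `exists_isDensity_hasSpectrum_uniform_marginals`, the stability / semigroup
property of Kronecker coefficients and their `S₃`-symmetry) up to ONE published input, the spectral
characterisation of the Kronecker polytope at rational points, vendored here as a named fact (the
hypothesis `hK`, verbatim):

* A. Klyachko, *Quantum marginal problem and representations of the symmetric group*,
  arXiv:quant-ph/0409113 (2004), in the form of M. Christandl, A. W. Harrow, G. Mitchison,
  *Nonzero Kronecker coefficients and what they tell us about spectra*, Comm. Math. Phys. 270
  (2007), **Thm. 2.3**: "For a density operator `ρ^{AB}` with the rational spectral triple
  `(r^A, r^B, r^{AB})` there is an integer `m > 0` such that `g_{m r^A, m r^B, m r^{AB}} ≠ 0`"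
  (proved there and by Klyachko through the finite generation of the Kronecker semigroup /
  geometric invariant theory, CHM Thm. 3.2).

This file lives next to its only consumer (the barrier catalogue entry); the fact itself is
representation theory / quantum information (density operators `IsDensity`, spectra `HasSpectrum`,
partial traces `traceLeft`/`traceRight` of `Literature/Computability/QuantumComplexity/QuantumMarginals.lean`,
Kronecker coefficients `kroneckerCoeff` and weights `Weight.ofPartition` of
`Literature/NumberTheory/DiophantineGeometry`). `BCI2011_thm1_holds_of` is the decomposition assembly.

## References

* [ChristandlHarrowMitchison2007] M. Christandl, A. W. Harrow, G. Mitchison, Comm. Math. Phys. 270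
  (2007) 575–585, Thm. 2.3, Thm. 3.1, Thm. 3.2.
* [Klyachko2004QuantumMarginal] A. Klyachko, arXiv:quant-ph/0409113 (2004).
* [BurgisserChristandlIkenmeyer2011] P. Bürgisser, M. Christandl, C. Ikenmeyer, Adv. Math. 227
  (2011), Thm. 1(2), Prop. 2, §5.1.
-/

noncomputable section

open scoped BigOperators

namespace Literature.Barriers.ValiantsHypothesis

open Literature.NumberTheory.DiophantineGeometry Literature.Computability.Complexity
  Literature.Computability.QuantumComplexity

/-- NAMED FACT — **Klyachko 2004 / Christandl–Harrow–Mitchison 2007, Thm. 2.3: rational spectral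
triples of density operators are stretched Kronecker triples.** "For a density operator `ρ^{AB}`
with the rational spectral triple `(r^A, r^B, r^{AB})` there is an integer `m > 0` such that
`g_{m r^A, m r^B, m r^{AB}} ≠ 0`." Here `ρ` is a density operator on `ℂ^a ⊗ ℂ^b` (a positive
semidefinite trace-one matrix on `Fin a × Fin b`, `IsDensity`), its spectral triple the decreasingly
ordered rational spectra `rA`, `rB`, `rAB` of the marginals `ρ_A = tr_B ρ` (`traceRight`),
`ρ_B = tr_A ρ` (`traceLeft`) and of `ρ` (listed along `Fin a × Fin b ≃ Fin (a·b)`), and the conclusion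
a `k > 0` with partitions `μ, ν, Λ ⊢ k` with at most `a`, `b`, `a·b` parts, of weights
`k·rA, k·rB, k·rAB`, and `g(μ, ν, Λ) ≠ 0` (the tree's `kroneckerCoeff ℂ`, multiplicity of `[μ]` in
`[ν] ⊗ [Λ]`). [cite: ChristandlHarrowMitchison2007, Thm. 2.3] [cite: BurgisserChristandlIkenmeyer2011, §2.3 and §5.1] -/
def Klyachko2004_rationalSpectralTriple_kronecker : Prop :=
  ∀ (a b : ℕ) [NeZero a] [NeZero b] (ρ : Matrix (Fin a × Fin b) (Fin a × Fin b) ℂ),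
    IsDensity ρ → ∀ (rA : Fin a → ℚ) (rB : Fin b → ℚ) (rAB : Fin (a * b) → ℚ),
    Antitone rA → Antitone rB → Antitone rAB →
    HasSpectrum (traceRight ρ) (fun i => (rA i : ℝ)) →
    HasSpectrum (traceLeft ρ) (fun i => (rB i : ℝ)) →
    HasSpectrum ρ (fun p => (rAB (finProdFinEquiv p) : ℝ)) →
    ∃ k : ℕ, 0 < k ∧ ∃ (μ : Nat.Partition k) (ν : Nat.Partition k) (Λ : Nat.Partition k),
      μ.parts.card ≤ a ∧ ν.parts.card ≤ b ∧ Λ.parts.card ≤ a * b ∧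
      (∀ i, (Weight.ofPartition a μ i : ℚ) = k * rA i) ∧
      (∀ i, (Weight.ofPartition b ν i : ℚ) = k * rB i) ∧
      (∀ i, (Weight.ofPartition (a * b) Λ i : ℚ) = k * rAB i) ∧
      kroneckerCoeff ℂ μ ν Λ ≠ 0

/-- **BCI 2011, Thm. 1(2), from Klyachko's theorem** (decomposition assembly of the named fact
`BCI2011_thm1`): the tree's proved `BCI2011_thm1_of_klyachko` (BCI §5.1: the density operator of
Prop. 2 with spectrum `λ̄` and uniform marginals, stretching by `ℓd`, `S₃`-symmetry).
[cite: BurgisserChristandlIkenmeyer2011, Thm. 1(2) and §5.1] -/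
theorem BCI2011_thm1_holds_of : Klyachko2004_rationalSpectralTriple_kronecker → BCI2011_thm1 :=
  fun hK => BCI2011_thm1_of_klyachko hK

end Literature.Barriers.ValiantsHypothesis

end
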